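import Literature.NumberTheory.LFunctions.CentralValueFamilyToZeroFreeRegion
import HarnessLib

/-!
# `𝓗_k(N)` over an arbitrary CLASS of admissible levels, and the square tower `N = q·n²`
# (½-proportion edge, §D edge fam — typing socket for level-class cards)

Topic `Literature/NumberTheory/LFunctions` (namespace
`Literature.NumberTheory.LFunctions.CentralValueFamilyHalfEdge`). Cell `landau-siegel`, §D typer
(edge fam = the ½-proportion edge). Vocabulary + kernel algebra only: no named fact, no claim.

The datum of record `iwaniecSarnakFamily k` (`IwaniecSarnakFamilyHalfEdge`) has
`Admissible N := Squarefree N` hard-wired — the admissibility of Iwaniec's §7 («`N` squarefree»,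
[IwaniecConversations2006, §7 p. 95]). The devices `restrict` / `refine` only NARROW it, so a card
whose family runs over NON-squarefree levels (the square tower `N = q·n²`, prime-power levels, …)
has no admissible parameter in that datum. This file supplies the socket:

* `iwaniecSarnakFamilyOn k A` — the same forms `newforms0 N k`, weights `ω_f`, parities `w_f = 1`,
  values `re L(½,f)`, `re L(½,f ⊗ χ)` and compatibility `(N,D) = 1 ∧ χ(−N) = 1` as
  `iwaniecSarnakFamily k`, with admissibility an ARBITRARY class `A : ℕ⁺ → Prop`
  (`iwaniecSarnakFamilyOn_squarefree : … Squarefree = iwaniecSarnakFamily k`, `rfl`). Every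
  statistic (`evenMass`, `goodMass`, `goodTwistedMass`, `mixedMoment`, `totalMass`) is the SAME
  real number as for `iwaniecSarnakFamily k` (`rfl` lemmas), so the print-typed pointwise facts at a
  level keep their meaning; only WHICH levels the asymptotic shapes quantify over changes.
* `NonnegOn` from the Lapid–Rallis fact verbatim (`iwaniecSarnakFamilyOn_nonnegOn`); a compatible
  supply by Linnik for every class containing all large PRIME levels
  (`iwaniecSarnakFamilyOn_compatibleSupply`); hence the decision theorems of record apply:
  pointwise (TARGETS (F) row) `lOne_lowerBound_iwaniecSarnakFamilyOn_total` /
  `lOneLowerBound_iwaniecSarnakFamilyOn_total` ⊢ `Zhang2022.Skeleton.LOneLowerBound (2a)`, and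
  level-averaged over ANY admissible compatible window scheme (TARGETS (A) row)
  `lOne_lowerBound_iwaniecSarnakFamilyOn_levelAvg_total` / `lOneLowerBound_…`.
* The SQUARE TOWER: `towerLevel q n = q·n²`, class `squareTower` (levels `q·n²`, `q` prime,
  `n ≥ 1`; it contains every prime, `squareTower_of_prime`), and the PARITY-CONSTANT lemma
  `compatible_towerLevel_iff`: for a real character `χ mod D` and `(n, D) = 1`,
  `(q·n², χ)` is compatible iff `(q, D) = 1 ∧ χ(−q) = 1` — the twisted root number
  `w(f ⊗ χ) = χ(−N)·w(f)` ((4.10), [IwaniecConversations2006, §4]) is CONSTANT up the tower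
  `N = q·n²`, so ONE compatible base prime `q` makes every level of the tower compatible: a
  level average over `n` is a compatible average with no character condition on `n` beyond
  `(n, D) = 1`. The tower window scheme `towerWindow sel` (`sel` = the card's base-prime selector
  `q = sel D χ`; levels `q·n² ∈ [X, 2X]`, `(n, D) = 1`) satisfies `WindowBound … 2`
  (`windowBound_towerWindow`) and `WindowCompatible` (`windowCompatible_towerWindow`, from the
  selector's `(q, D) = 1 ∧ χ(−q) = 1`), and the end-to-end display
  `lOneLowerBound_of_towerLevelAvg_total` turns the four averaged shapes on the tower (even share,
  total-mass mixed moment, twisted half at `p₂`, the EDGE `EStarFamLevelAvg (ntWindow (towerWindow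
  sel)) p₁ a δ` with `p₁ + p₂ > 1`) into `Skeleton.LOneLowerBound (2a)`. The shapes at
  non-squarefree levels are HYPOTHESES displayed by name — print's `iwaniec2006_twistedHalf` /
  `iwaniec2006_mixedMomentOverMass` are squarefree-level statements and do not discharge them.

WHAT THIS IS NOT: no claim that any edge shape holds on any class. «The programme SEARCHES and
TYPES; no claim about Landau–Siegel zeros, Theorems 1–2 of arXiv:2211.02515 or a repaired Margin232
until a kernel theorem says so.»

## References

* [IwaniecConversations2006] H. Iwaniec, *Conversations on the exceptional character*, LNM 1891
  (2006), §4 (4.10) p. 89 and §7 (7.1)–(7.7) pp. 95–97 (held: p0089, p0095–p0097).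
* [Linnik1944] U. V. Linnik, *On the least prime in an arithmetic progression*, Mat. Sb. 15
  (1944) — tree `Literature.NumberTheory.Sieve.linnik_leastPrimeAP`.
* Tree: `IwaniecSarnakFamilyHalfEdge` (p459497), `CentralValueFamilyNontrivialTwist` (p466418),
  `CentralValueFamilyLevelAvgTotal` (p468411), `CentralValueFamilyToZeroFreeRegion` (p470348).
-/

noncomputable section

namespace Literature.NumberTheory.LFunctions.CentralValueFamilyHalfEdge

open scoped MatrixGroups
open Finset Real CongruenceSubgroup
open Literature.NumberTheory.EllipticCurves.ModularForms
open Literature.NumberTheory.LFunctions.IwaniecSarnak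
open Literature.NumberTheory.LFunctions.Zhang2022

/-! ## The level-class datum -/

/-- **`𝓗_k(N)` over a level class `A`**: the datum `iwaniecSarnakFamily k` (levels `N ∈ ℕ⁺`,
newforms `newforms0 N k`, harmonic weights, root-number parity, `re L(½,f)`, `re L(½,f ⊗ χ)`,
compatibility `(N,D) = 1 ∧ χ(−N) = 1`) with admissibility replaced by the class `A` (print:
`A = Squarefree`, §7 p. 95; a card may name prime powers, the square tower `q·n²`, …).
[cite: IwaniecConversations2006, §7 (7.1)–(7.6)] -/
abbrev iwaniecSarnakFamilyOn (k : ℤ) (A : ℕ+ → Prop) : CentralValueFamily :=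
  { iwaniecSarnakFamily k with Admissible := A }

section LevelClass

variable {k : ℤ} {A : ℕ+ → Prop}

/-- The squarefree class gives back the datum of record. [cite: IwaniecConversations2006, §7 (p. 95)] -/
theorem iwaniecSarnakFamilyOn_squarefree (k : ℤ) :
    iwaniecSarnakFamilyOn k (fun N => Squarefree (N : ℕ)) = iwaniecSarnakFamily k := rfl

/-- Admissibility in the level-class datum is membership in the class. [cite: IwaniecConversations2006, §7 (p. 95)] -/
@[simp] theorem iwaniecSarnakFamilyOn_admissible (N : ℕ+) :
    (iwaniecSarnakFamilyOn k A).Admissible N ↔ A N := Iff.rfl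

/-- Same size. [cite: IwaniecConversations2006, §7 (7.3)] -/
@[simp] theorem iwaniecSarnakFamilyOn_size (N : ℕ+) :
    (iwaniecSarnakFamilyOn k A).size N = ((N : ℕ) : ℝ) := rfl

/-- Same compatibility `(N,D) = 1 ∧ χ(−N) = 1`. [cite: IwaniecConversations2006, §4 (4.10)] -/
theorem iwaniecSarnakFamilyOn_compatible_iff (N : ℕ+) {D : ℕ} (χ : DirichletCharacter ℂ D) :
    (iwaniecSarnakFamilyOn k A).Compatible N χ ↔
      (N : ℕ).Coprime D ∧ χ (-((N : ℕ) : ZMod D)) = 1 := Iff.rfl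

/-- Same even forms. [cite: IwaniecConversations2006, §7 (7.3)] -/
@[simp] theorem evenForms_iwaniecSarnakFamilyOn (N : ℕ+) :
    (iwaniecSarnakFamilyOn k A).evenForms N = (iwaniecSarnakFamily k).evenForms N := rfl

/-- Same even mass. [cite: IwaniecConversations2006, §7 (7.3)] -/
@[simp] theorem evenMass_iwaniecSarnakFamilyOn (N : ℕ+) :
    (iwaniecSarnakFamilyOn k A).evenMass N = (iwaniecSarnakFamily k).evenMass N := rfl

/-- Same total mass. [cite: IwaniecConversations2006, §7 (7.3)] -/
@[simp] theorem totalMass_iwaniecSarnakFamilyOn (N : ℕ+) :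
    (iwaniecSarnakFamilyOn k A).totalMass N = (iwaniecSarnakFamily k).totalMass N := rfl

/-- Same (7.5)-mass. [cite: IwaniecConversations2006, §7 (7.5)] -/
@[simp] theorem goodMass_iwaniecSarnakFamilyOn (a : ℕ) (N : ℕ+) :
    (iwaniecSarnakFamilyOn k A).goodMass a N = (iwaniecSarnakFamily k).goodMass a N := rfl

/-- Same (7.6)-mass. [cite: IwaniecConversations2006, §7 (7.6)] -/
@[simp] theorem goodTwistedMass_iwaniecSarnakFamilyOn (a : ℕ) (N : ℕ+) {D : ℕ}
    (χ : DirichletCharacter ℂ D) :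
    (iwaniecSarnakFamilyOn k A).goodTwistedMass a N χ =
      (iwaniecSarnakFamily k).goodTwistedMass a N χ := rfl

/-- Same mixed moment (7.4). [cite: IwaniecConversations2006, §7 (7.4)] -/
@[simp] theorem mixedMoment_iwaniecSarnakFamilyOn (N : ℕ+) {D : ℕ} (χ : DirichletCharacter ℂ D) :
    (iwaniecSarnakFamilyOn k A).mixedMoment N χ = (iwaniecSarnakFamily k).mixedMoment N χ := rfl

/-- **Non-negativity on a level class, as printed** (`ω_f ≥ 0`, `re L(½,f) ≥ 0`,
`re L(½,f ⊗ χ_D) ≥ 0` for real primitive `χ_D` with `(N,D) = 1`) — the Lapid–Rallis fact is a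
statement at EVERY level, so it serves every class. [cite: LapidRallis2003, Thm. 1 (case n = 2)] -/
theorem iwaniecSarnakFamilyOn_nonnegOn (hk : 2 ≤ k) (h : lapidRallis2003_theorem1_gl2Twist) :
    (iwaniecSarnakFamilyOn k A).NonnegOn := by
  refine fun (N : ℕ+) (f : CuspForm (Gamma0 (N : ℕ)) k) hf => ?_
  have hf' : f ∈ newforms0 (N : ℕ) k := mem_forms_iwaniecSarnakFamily.1 hf
  refine ⟨harmonicWeight_nonneg hk f, (centralValue_nonneg h hf').2, ?_⟩
  intro D _ χ hprim hquad hcomp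
  exact (h (N : ℕ) k f hf' D χ hprim hquad hcomp.1).2

/-- **Prime-level structure on a level class containing all large primes**: the levels, sizes and
compatibility of `iwaniecSarnakPrimeLevels k` (a prime `p > D`, `p ≡ −1 (mod D)` is compatible with
every `χ mod D`), admissibility from the class hypothesis. [cite: IwaniecConversations2006, §4 (4.10)] -/
def iwaniecSarnakPrimeLevelsOn (k : ℤ) (A : ℕ+ → Prop) (N₀ : ℕ)
    (hA : ∀ p : ℕ, (hp : p.Prime) → N₀ ≤ p → A ⟨p, hp.pos⟩) :
    (iwaniecSarnakFamilyOn k A).PrimeLevels where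
  lvl := (iwaniecSarnakPrimeLevels k).lvl
  size_lvl := (iwaniecSarnakPrimeLevels k).size_lvl
  N₀ := N₀
  admissible := fun p hp hN => by
    have h1 : (iwaniecSarnakPrimeLevels k).lvl p = ⟨p, hp.pos⟩ := by
      apply PNat.eq
      show max p 1 = p
      exact max_eq_left hp.one_lt.le
    show A ((iwaniecSarnakPrimeLevels k).lvl p)
    rw [h1]
    exact hA p hp hN
  compatible := (iwaniecSarnakPrimeLevels k).compatible

/-- **Linnik supplies compatible levels in every class containing all large primes**: for every
`δ > 0` there is `K > 0` with `(iwaniecSarnakFamilyOn k A).CompatibleSupply δ K`. [cite: Linnik1944] -/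
theorem iwaniecSarnakFamilyOn_compatibleSupply (k : ℤ) {N₀ : ℕ}
    (hA : ∀ p : ℕ, (hp : p.Prime) → N₀ ≤ p → A ⟨p, hp.pos⟩) {δ : ℝ} (hδ : 0 < δ) :
    ∃ K : ℝ, 0 < K ∧ (iwaniecSarnakFamilyOn k A).CompatibleSupply δ K :=
  (iwaniecSarnakFamilyOn k A).compatibleSupply_of_primeLevels (iwaniecSarnakPrimeLevelsOn k A N₀ hA) hδ

/-! ## Decision theorems on a level class (TARGETS rows (F) and (A)) -/

/-- **Pointwise edge on a level class ⇒ `L(1,χ_D) ≫ (log D)^{−2a}`** (TARGETS (F) row instantiated):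
Lapid–Rallis, a class containing all large primes (supply), and — as DISPLAYED HYPOTHESES on the
class datum — the even share `EvenShare`, the printed total-mass moment shape `MixedOverTotalMass δ`,
the twisted half at `p₂`, and the EDGE `EStarFam p₁ a` with `p₁ + p₂ > 1`.
[cite: IwaniecConversations2006, §7 (7.7)] -/
theorem lOne_lowerBound_iwaniecSarnakFamilyOn_total (hk : 2 ≤ k)
    (hLR : lapidRallis2003_theorem1_gl2Twist) {N₀ : ℕ}
    (hA : ∀ p : ℕ, (hp : p.Prime) → N₀ ≤ p → A ⟨p, hp.pos⟩) {p₁ p₂ δ : ℝ} {a : ℕ} (hδ : 0 < δ)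
    (hsh : (iwaniecSarnakFamilyOn k A).EvenShare)
    (htot : (iwaniecSarnakFamilyOn k A).MixedOverTotalMass δ)
    (htw : (iwaniecSarnakFamilyOn k A).TwistedHalf p₂ a δ)
    (hE : (iwaniecSarnakFamilyOn k A).EStarFam p₁ a) (hp : 1 < p₁ + p₂) :
    ∃ c : ℝ, 0 < c ∧ ∃ D₀ : ℕ, ∀ (D : ℕ) [NeZero D] (χ : DirichletCharacter ℂ D), D₀ ≤ D →
      χ.IsPrimitive → MulChar.IsQuadratic χ →
        c * ((Real.log D) ^ (2 * a))⁻¹ ≤ (χ.LFunction 1).re := by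
  obtain ⟨K, hK, hsup⟩ := iwaniecSarnakFamilyOn_compatibleSupply k hA hδ
  exact (iwaniecSarnakFamilyOn k A).lOne_lowerBound_of_EStarFam_total hK
    (iwaniecSarnakFamilyOn_nonnegOn hk hLR) hsh htot htw hE hp hsup

/-- The same, in the summit vocabulary: `Zhang2022.Skeleton.LOneLowerBound (2a)`.
[cite: IwaniecConversations2006, §7 (7.7)] -/
theorem lOneLowerBound_iwaniecSarnakFamilyOn_total (hk : 2 ≤ k)
    (hLR : lapidRallis2003_theorem1_gl2Twist) {N₀ : ℕ}
    (hA : ∀ p : ℕ, (hp : p.Prime) → N₀ ≤ p → A ⟨p, hp.pos⟩) {p₁ p₂ δ : ℝ} {a : ℕ} (hδ : 0 < δ)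
    (hsh : (iwaniecSarnakFamilyOn k A).EvenShare)
    (htot : (iwaniecSarnakFamilyOn k A).MixedOverTotalMass δ)
    (htw : (iwaniecSarnakFamilyOn k A).TwistedHalf p₂ a δ)
    (hE : (iwaniecSarnakFamilyOn k A).EStarFam p₁ a) (hp : 1 < p₁ + p₂) :
    Skeleton.LOneLowerBound (2 * a) := by
  obtain ⟨K, hK, hsup⟩ := iwaniecSarnakFamilyOn_compatibleSupply k hA hδ
  exact CentralValueFamily.lOneLowerBound_of_EStarFam_total hK
    (iwaniecSarnakFamilyOn_nonnegOn hk hLR) hsh htot htw hE hp hsup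

/-- **Level-averaged edge on a level class ⇒ `L(1,χ_D) ≫ (log D)^{−2a}`** (TARGETS (A) row, any
window): over a window scheme `win` of ADMISSIBLE (class `A`) COMPATIBLE levels of size in `[X, KX]`
(`WindowBound`, `WindowCompatible`), with the averaged even share, the averaged total-mass moment
shape, the averaged twisted half at `p₂` and the averaged EDGE at `p₁` on the guarded scheme
`ntWindow win`, `p₁ + p₂ > 1`. [cite: IwaniecConversations2006, §7 (7.7) and p0097:L15] -/
theorem lOne_lowerBound_iwaniecSarnakFamilyOn_levelAvg_total (hk : 2 ≤ k)
    (hLR : lapidRallis2003_theorem1_gl2Twist)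
    {win : ℝ → (D : ℕ) → DirichletCharacter ℂ D → Finset ℕ+} {p₁ p₂ δ K : ℝ} {a : ℕ}
    (hδ : 0 < δ) (hK : 1 ≤ K)
    (hW : (iwaniecSarnakFamilyOn k A).WindowBound win δ K)
    (hWC : (iwaniecSarnakFamilyOn k A).WindowCompatible win δ)
    (hsh : (iwaniecSarnakFamilyOn k A).EvenShareAvg win δ)
    (hmix : (iwaniecSarnakFamilyOn k A).MixedOverTotalMassAvg win δ)
    (htw : (iwaniecSarnakFamilyOn k A).TwistedHalfAvg ((iwaniecSarnakFamilyOn k A).ntWindow win) p₂ a δ)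
    (hE : (iwaniecSarnakFamilyOn k A).EStarFamLevelAvg ((iwaniecSarnakFamilyOn k A).ntWindow win) p₁ a δ)
    (hp : 1 < p₁ + p₂) :
    ∃ c : ℝ, 0 < c ∧ ∃ D₀ : ℕ, ∀ (D : ℕ) [NeZero D] (χ : DirichletCharacter ℂ D), D₀ ≤ D →
      χ.IsPrimitive → MulChar.IsQuadratic χ →
        c * ((Real.log D) ^ (2 * a))⁻¹ ≤ (χ.LFunction 1).re :=
  (iwaniecSarnakFamilyOn k A).lOne_lowerBound_of_EStarFamLevelAvg_total hδ hK
    (iwaniecSarnakFamilyOn_nonnegOn hk hLR) hW hWC hsh hmix htw hE hp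

/-- The same, in the summit vocabulary: `Zhang2022.Skeleton.LOneLowerBound (2a)`.
[cite: IwaniecConversations2006, §7 (7.7) and p0097:L15] -/
theorem lOneLowerBound_iwaniecSarnakFamilyOn_levelAvg_total (hk : 2 ≤ k)
    (hLR : lapidRallis2003_theorem1_gl2Twist)
    {win : ℝ → (D : ℕ) → DirichletCharacter ℂ D → Finset ℕ+} {p₁ p₂ δ K : ℝ} {a : ℕ}
    (hδ : 0 < δ) (hK : 1 ≤ K)
    (hW : (iwaniecSarnakFamilyOn k A).WindowBound win δ K)
    (hWC : (iwaniecSarnakFamilyOn k A).WindowCompatible win δ)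
    (hsh : (iwaniecSarnakFamilyOn k A).EvenShareAvg win δ)
    (hmix : (iwaniecSarnakFamilyOn k A).MixedOverTotalMassAvg win δ)
    (htw : (iwaniecSarnakFamilyOn k A).TwistedHalfAvg ((iwaniecSarnakFamilyOn k A).ntWindow win) p₂ a δ)
    (hE : (iwaniecSarnakFamilyOn k A).EStarFamLevelAvg ((iwaniecSarnakFamilyOn k A).ntWindow win) p₁ a δ)
    (hp : 1 < p₁ + p₂) :
    Skeleton.LOneLowerBound (2 * a) := by
  refine lOneLowerBound_of_eventual ?_
  obtain ⟨c, hc, D₀, h⟩ := lOne_lowerBound_iwaniecSarnakFamilyOn_levelAvg_total hk hLR hδ hK hW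
    hWC hsh hmix htw hE hp
  exact ⟨c, hc, D₀, fun D _ χ hD hprim hquad => h D χ hD hprim hquad⟩

end LevelClass

/-! ## The square tower `N = q·n²` — parity-constant compatibility -/

section Tower

variable {k : ℤ} {A : ℕ+ → Prop}

/-- The tower level `q·n²` (as a positive natural). [cite: IwaniecConversations2006, §4 (4.10)] -/
def towerLevel (q n : ℕ+) : ℕ+ := q * n ^ 2

/-- `towerLevel q n = q·n²` in `ℕ`. [cite: IwaniecConversations2006, §4 (4.10)] -/
@[simp] theorem towerLevel_coe (q n : ℕ+) : ((towerLevel q n : ℕ+) : ℕ) = (q : ℕ) * (n : ℕ) ^ 2 := by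
  simp [towerLevel]

/-- The base of the tower: `towerLevel q 1 = q`. [cite: IwaniecConversations2006, §4 (4.10)] -/
@[simp] theorem towerLevel_one (q : ℕ+) : towerLevel q 1 = q := by
  simp [towerLevel]

/-- **The square-tower class**: levels `N = q·n²` with `q` prime and `n ≥ 1` (NOT squarefree for
`n > 1`, hence outside the admissibility of `iwaniecSarnakFamily k`). [cite: IwaniecConversations2006, §7 (p. 95)] -/
def squareTower (N : ℕ+) : Prop :=
  ∃ q n : ℕ+, (q : ℕ).Prime ∧ N = towerLevel q n

/-- Tower levels over a prime base are in the class. [cite: IwaniecConversations2006, §7 (p. 95)] -/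
theorem squareTower_towerLevel {q : ℕ+} (hq : (q : ℕ).Prime) (n : ℕ+) :
    squareTower (towerLevel q n) := ⟨q, n, hq, rfl⟩

/-- Every prime level is in the square-tower class (`n = 1`), so Linnik's supply serves it.
[cite: IwaniecConversations2006, §7 (p0096:L27)] -/
theorem squareTower_of_prime (p : ℕ) (hp : p.Prime) : squareTower ⟨p, hp.pos⟩ :=
  ⟨⟨p, hp.pos⟩, 1, hp, by rw [towerLevel_one]⟩

/-- Compatible supply for the square-tower datum in every uniformity range. [cite: Linnik1944] -/
theorem squareTower_compatibleSupply (k : ℤ) {δ : ℝ} (hδ : 0 < δ) :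
    ∃ K : ℝ, 0 < K ∧ (iwaniecSarnakFamilyOn k squareTower).CompatibleSupply δ K :=
  iwaniecSarnakFamilyOn_compatibleSupply k (N₀ := 0) (fun p hp _ => squareTower_of_prime p hp) hδ

/-- A real (quadratic) character takes the value `1` on the square of a unit. [folklore] -/
private theorem quadratic_apply_sq_of_coprime {D : ℕ} (χ : DirichletCharacter ℂ D)
    (hχ : MulChar.IsQuadratic χ) {n : ℕ} (hn : n.Coprime D) :
    χ (((n : ℕ) : ZMod D) ^ 2) = 1 := by
  have hu : IsUnit ((n : ℕ) : ZMod D) := (ZMod.isUnit_iff_coprime n D).mpr hn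
  rw [map_pow]
  rcases hχ ((n : ℕ) : ZMod D) with h0 | h1 | h2
  · exact absurd h0 (hu.map χ).ne_zero
  · rw [h1, one_pow]
  · rw [h2]; norm_num

/-- **Parity-constant tower.** For a real character `χ mod D` and `(n, D) = 1`: the pair
`(q·n², χ)` is compatible (`(q n², D) = 1 ∧ χ(−q n²) = 1`) iff `(q, D) = 1 ∧ χ(−q) = 1`. By (4.10),
`w(f ⊗ χ) = χ(−N) w(f)`: the sign `χ(−q·n²) = χ(−q)·χ(n)² = χ(−q)` does not depend on `n`, so one
compatible base prime makes the whole tower compatible. [cite: IwaniecConversations2006, §4 (4.10)] -/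
theorem compatible_towerLevel_iff (k : ℤ) (A : ℕ+ → Prop) {q n : ℕ+} {D : ℕ}
    (χ : DirichletCharacter ℂ D) (hχ : MulChar.IsQuadratic χ) (hn : (n : ℕ).Coprime D) :
    (iwaniecSarnakFamilyOn k A).Compatible (towerLevel q n) χ ↔
      (q : ℕ).Coprime D ∧ χ (-((q : ℕ) : ZMod D)) = 1 := by
  rw [iwaniecSarnakFamilyOn_compatible_iff, towerLevel_coe]
  have hsq : χ (((n : ℕ) : ZMod D) ^ 2) = 1 := quadratic_apply_sq_of_coprime χ hχ hn
  have hval : χ (-(((q : ℕ) * (n : ℕ) ^ 2 : ℕ) : ZMod D)) = χ (-((q : ℕ) : ZMod D)) := by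
    have : (-(((q : ℕ) * (n : ℕ) ^ 2 : ℕ) : ZMod D)) =
        (-((q : ℕ) : ZMod D)) * ((n : ℕ) : ZMod D) ^ 2 := by push_cast; ring
    rw [this, map_mul, hsq, mul_one]
  have hcop : ((q : ℕ) * (n : ℕ) ^ 2).Coprime D ↔ (q : ℕ).Coprime D := by
    constructor
    · exact fun h => Nat.Coprime.coprime_mul_right h
    · exact fun h => Nat.Coprime.mul_left h (Nat.Coprime.pow_left 2 hn)
  rw [hval, hcop]

/-- The same for the datum of record's compatibility predicate (which `iwaniecSarnakFamilyOn`
shares). [cite: IwaniecConversations2006, §4 (4.10)] -/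
theorem compatible_towerLevel_iff' (k : ℤ) {q n : ℕ+} {D : ℕ}
    (χ : DirichletCharacter ℂ D) (hχ : MulChar.IsQuadratic χ) (hn : (n : ℕ).Coprime D) :
    (iwaniecSarnakFamily k).Compatible (towerLevel q n) χ ↔
      (q : ℕ).Coprime D ∧ χ (-((q : ℕ) : ZMod D)) = 1 :=
  compatible_towerLevel_iff k (fun N => Squarefree (N : ℕ)) χ hχ hn

/-! ### The tower window scheme -/

open scoped Classical in
/-- **The tower window** at scale `X` for `χ mod D` over the base prime `q = sel D χ` (the card's
selector): the levels `q·n²` with `(n, D) = 1` and `X ≤ q·n² ≤ 2X`, as a `Finset ℕ⁺` (indices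
`n ≤ ⌊2X⌋₊ + 1` suffice since `n ≤ n² ≤ q n² ≤ 2X`). [cite: IwaniecConversations2006, §7 (p0097:L15)] -/
def towerWindow (sel : (D : ℕ) → DirichletCharacter ℂ D → ℕ+) (X : ℝ) (D : ℕ)
    (χ : DirichletCharacter ℂ D) : Finset ℕ+ :=
  ((Finset.Icc (1 : ℕ+) (Nat.toPNat' (⌊2 * X⌋₊ + 1))).filter
    (fun n : ℕ+ => (n : ℕ).Coprime D ∧ X ≤ (((sel D χ : ℕ+) : ℕ) * (n : ℕ) ^ 2 : ℝ) ∧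
      (((sel D χ : ℕ+) : ℕ) * (n : ℕ) ^ 2 : ℝ) ≤ 2 * X)).image
    (fun n => towerLevel (sel D χ) n)

variable {sel : (D : ℕ) → DirichletCharacter ℂ D → ℕ+}

/-- Members of the tower window: `N = q·n²` over the selected base with `(n, D) = 1` and
`X ≤ N ≤ 2X`. [cite: IwaniecConversations2006, §7 (p0097:L15)] -/
theorem mem_towerWindow {X : ℝ} {D : ℕ} {χ : DirichletCharacter ℂ D} {N : ℕ+}
    (hN : N ∈ towerWindow sel X D χ) :
    ∃ n : ℕ+, N = towerLevel (sel D χ) n ∧ (n : ℕ).Coprime D ∧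
      X ≤ ((N : ℕ) : ℝ) ∧ ((N : ℕ) : ℝ) ≤ 2 * X := by
  classical
  rw [towerWindow, Finset.mem_image] at hN
  obtain ⟨n, hn, rfl⟩ := hN
  rw [Finset.mem_filter] at hn
  obtain ⟨-, hcop, hlo, hhi⟩ := hn
  refine ⟨n, rfl, hcop, ?_, ?_⟩
  · rw [towerLevel_coe]; exact_mod_cast hlo
  · rw [towerLevel_coe]; exact_mod_cast hhi

/-- **The tower window is bounded** (`WindowBound … 2`, every `δ`) on the square-tower datum once
the selector picks PRIMES: members are admissible (`q·n²`, `q` prime) with `X ≤ N ≤ 2X`.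
[cite: IwaniecConversations2006, §7 (p0097:L15)] -/
theorem windowBound_towerWindow (k : ℤ) (δ : ℝ)
    (hsel : ∀ (D : ℕ) (χ : DirichletCharacter ℂ D), ((sel D χ : ℕ+) : ℕ).Prime) :
    (iwaniecSarnakFamilyOn k squareTower).WindowBound (towerWindow sel) δ 2 := by
  refine ⟨1, fun X _ D _ χ _ _ _ (N : ℕ+) hN => ?_⟩
  obtain ⟨n, rfl, -, hlo, hhi⟩ := mem_towerWindow hN
  exact ⟨squareTower_towerLevel (hsel D χ) n, hlo, hhi⟩

/-- **The tower window is compatible** (`WindowCompatible`, every `δ`) on any level class, once the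
selector picks a base `q` with `(q, D) = 1` and `χ(−q) = 1` for the real primitive `χ mod D` in
question: parity is constant up the tower (`compatible_towerLevel_iff`).
[cite: IwaniecConversations2006, §4 (4.10)] -/
theorem windowCompatible_towerWindow (k : ℤ) (A : ℕ+ → Prop) (δ : ℝ)
    (hsel : ∀ (D : ℕ) [NeZero D] (χ : DirichletCharacter ℂ D), χ.IsPrimitive →
      MulChar.IsQuadratic χ → ((sel D χ : ℕ+) : ℕ).Coprime D ∧ χ (-(((sel D χ : ℕ+) : ℕ) : ZMod D)) = 1) :
    (iwaniecSarnakFamilyOn k A).WindowCompatible (towerWindow sel) δ := by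
  refine ⟨0, fun X _ D _ χ hprim hquad _ (N : ℕ+) hN => ?_⟩
  obtain ⟨n, rfl, hcop, -, -⟩ := mem_towerWindow hN
  exact (compatible_towerLevel_iff k A χ hquad hcop).mpr (hsel D χ hprim hquad)

/-- **THE TOWER DISPLAY (end-to-end).** On the square-tower datum `iwaniecSarnakFamilyOn k squareTower`
with a selector of compatible base primes (`q = sel D χ` prime, `(q,D) = 1`, `χ(−q) = 1`):
Lapid–Rallis non-negativity, and — as DISPLAYED HYPOTHESES, none of them a printed fact at
non-squarefree levels — the averaged even share and total-mass mixed-moment shape on the tower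
window, the averaged twisted half at `p₂` and the EDGE `EStarFamLevelAvg (ntWindow (towerWindow sel))
p₁ a δ` (harmonic proportion `≥ p₁` of the even newforms of ALL levels `q·n² ∈ [X,2X]`, `(n,D) = 1`,
with `L(½,f) ≥ (log N)⁻ᵃ`), `p₁ + p₂ > 1` ⇒ `Zhang2022.Skeleton.LOneLowerBound (2a)`.
[cite: IwaniecConversations2006, §7 (7.7) and p0097:L15] -/
theorem lOneLowerBound_of_towerLevelAvg_total (hk : 2 ≤ k) (hLR : lapidRallis2003_theorem1_gl2Twist)
    (hselP : ∀ (D : ℕ) (χ : DirichletCharacter ℂ D), ((sel D χ : ℕ+) : ℕ).Prime)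
    (hselC : ∀ (D : ℕ) [NeZero D] (χ : DirichletCharacter ℂ D), χ.IsPrimitive →
      MulChar.IsQuadratic χ → ((sel D χ : ℕ+) : ℕ).Coprime D ∧ χ (-(((sel D χ : ℕ+) : ℕ) : ZMod D)) = 1)
    {p₁ p₂ δ : ℝ} {a : ℕ} (hδ : 0 < δ)
    (hsh : (iwaniecSarnakFamilyOn k squareTower).EvenShareAvg (towerWindow sel) δ)
    (hmix : (iwaniecSarnakFamilyOn k squareTower).MixedOverTotalMassAvg (towerWindow sel) δ)
    (htw : (iwaniecSarnakFamilyOn k squareTower).TwistedHalfAvg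
      ((iwaniecSarnakFamilyOn k squareTower).ntWindow (towerWindow sel)) p₂ a δ)
    (hE : (iwaniecSarnakFamilyOn k squareTower).EStarFamLevelAvg
      ((iwaniecSarnakFamilyOn k squareTower).ntWindow (towerWindow sel)) p₁ a δ)
    (hp : 1 < p₁ + p₂) :
    Skeleton.LOneLowerBound (2 * a) :=
  lOneLowerBound_iwaniecSarnakFamilyOn_levelAvg_total hk hLR hδ (by norm_num : (1 : ℝ) ≤ 2)
    (windowBound_towerWindow k δ hselP) (windowCompatible_towerWindow k squareTower δ hselC)
    hsh hmix htw hE hp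

/-- The `L(1,χ)` form of the tower display: `∃ c > 0, L(1,χ_D) ≥ c (log D)^{−2a}` for all large
`D`. [cite: IwaniecConversations2006, §7 (7.7) and p0097:L15] -/
theorem lOne_lowerBound_of_towerLevelAvg_total (hk : 2 ≤ k) (hLR : lapidRallis2003_theorem1_gl2Twist)
    (hselP : ∀ (D : ℕ) (χ : DirichletCharacter ℂ D), ((sel D χ : ℕ+) : ℕ).Prime)
    (hselC : ∀ (D : ℕ) [NeZero D] (χ : DirichletCharacter ℂ D), χ.IsPrimitive →
      MulChar.IsQuadratic χ → ((sel D χ : ℕ+) : ℕ).Coprime D ∧ χ (-(((sel D χ : ℕ+) : ℕ) : ZMod D)) = 1)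
    {p₁ p₂ δ : ℝ} {a : ℕ} (hδ : 0 < δ)
    (hsh : (iwaniecSarnakFamilyOn k squareTower).EvenShareAvg (towerWindow sel) δ)
    (hmix : (iwaniecSarnakFamilyOn k squareTower).MixedOverTotalMassAvg (towerWindow sel) δ)
    (htw : (iwaniecSarnakFamilyOn k squareTower).TwistedHalfAvg
      ((iwaniecSarnakFamilyOn k squareTower).ntWindow (towerWindow sel)) p₂ a δ)
    (hE : (iwaniecSarnakFamilyOn k squareTower).EStarFamLevelAvg
      ((iwaniecSarnakFamilyOn k squareTower).ntWindow (towerWindow sel)) p₁ a δ)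
    (hp : 1 < p₁ + p₂) :
    ∃ c : ℝ, 0 < c ∧ ∃ D₀ : ℕ, ∀ (D : ℕ) [NeZero D] (χ : DirichletCharacter ℂ D), D₀ ≤ D →
      χ.IsPrimitive → MulChar.IsQuadratic χ →
        c * ((Real.log D) ^ (2 * a))⁻¹ ≤ (χ.LFunction 1).re :=
  lOne_lowerBound_iwaniecSarnakFamilyOn_levelAvg_total hk hLR hδ (by norm_num : (1 : ℝ) ≤ 2)
    (windowBound_towerWindow k δ hselP) (windowCompatible_towerWindow k squareTower δ hselC)
    hsh hmix htw hE hp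

end Tower

end Literature.NumberTheory.LFunctions.CentralValueFamilyHalfEdge

end
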